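import Mathlib
import Summits.CriticalPhenomena.PercolationContinuityZ3.Theorems.PercNearOneGluingNoHeavyLowerTailFatMinorityOnePortCertificate
import HarnessLib

/-!
# `NoHeavyLowerTail` (stmt-CriticalPhenomena-4575), line fat-minority-linear — Lemma-5 slack summed over a family of
# stars, and the WEAK-PORT REDUCTION (R1) of the up-set star inequality (route task `nh-dp-fatminority`, gen 9)

`μ = prodBernoulli w` on the pairs of `Fin n`, observer `o`, target `b`, competitor `c ≠ o`, `σ_B = starEvent o B`,
`R'(t) = μ(t ↔ b off o)` (`openConnIn {o}ᶜ`, the graph `G ∖ {o}` = the star of `o` deleted).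

* `cells_le_slack`: for any finite family `𝒱` of vertex sets and any selector `v B ∈ B` (`v B ≠ o`):
  `Σ_{B∈𝒱} [μ({c↔b} ∩ σ_B) − μ({o↔b} ∩ σ_B)] ≤ Σ_{B∈𝒱} (R'(c) − R'(v B))⁺ · μ(σ_B)`  (Kozma–Nitzan Lemma 5 with slack, cell by cell).
* `strongCells_le` (**weak-port reduction (R1)**, FINDINGS-fat-minority-gen9 §2): if every `B ∈ 𝒱` contains a STRONG port
  `v B` — one with `R'(v B) ≥ R'(c) − δ` — then `Σ_{B∈𝒱} [μ({c↔b} ∩ σ_B) − μ({o↔b} ∩ σ_B)] ≤ δ⁺ · Σ_{B∈𝒱} μ(σ_B)`: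
  cells containing a strong port never violate the signed star inequality with threshold `δ`, so proving QUT4/UT4 for an up-set
  `U` reduces to the sub-up-set generated by the cells of `U` inside the weak ports.  No new definitions.
-/

namespace Summit.CriticalPhenomena.PercolationContinuityZ3.Theorems

open MeasureTheory Set
open Literature.Probability.LatticeModels (prodBernoulli)
open Literature.Probability.Percolation

noncomputable section
open scoped Classical

variable {n : ℕ}

/-- **Lemma 5 with slack, summed over a family of stars.**  For every finite family `𝒱` of vertex sets and selector
`v` with `v B ∈ B`, `v B ≠ o` (`B ∈ 𝒱`), and `c ≠ o`:
`Σ_{B∈𝒱} [μ({c↔b} ∩ σ_B) − μ({o↔b} ∩ σ_B)] ≤ Σ_{B∈𝒱} (R'(c) − R'(v B))⁺ μ(σ_B)`, `R'(t) = μ(t ↔ b off o)`.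
[cite: KozmaNitzan2024, Lemma 5 p. 13 with Lemma 3 pp. 6–7 (quantitative form, tree `LossyStar.lemma5_add`)] -/
theorem cells_le_slack (w : Sym2 (Fin n) → unitInterval) (o c b : Fin n) (hco : c ≠ o)
    (𝒱 : Finset (Finset (Fin n))) (v : Finset (Fin n) → Fin n)
    (hv : ∀ B ∈ 𝒱, v B ∈ B) (hvo : ∀ B ∈ 𝒱, v B ≠ o) :
    ∑ B ∈ 𝒱, ((prodBernoulli w).real (openConn c b ∩ starEvent o (↑B : Set (Fin n))) -
        (prodBernoulli w).real (openConn o b ∩ starEvent o (↑B : Set (Fin n)))) ≤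
      ∑ B ∈ 𝒱, max 0 ((prodBernoulli w).real (openConnIn ({o}ᶜ : Set (Fin n)) c b) -
            (prodBernoulli w).real (openConnIn ({o}ᶜ : Set (Fin n)) (v B) b)) *
          (prodBernoulli w).real (starEvent o (↑B : Set (Fin n))) := by
  refine Finset.sum_le_sum fun B hB => ?_
  set δ : ℝ := max 0 ((prodBernoulli w).real (openConnIn ({o}ᶜ : Set (Fin n)) c b) -
      (prodBernoulli w).real (openConnIn ({o}ᶜ : Set (Fin n)) (v B) b)) with hδ
  have hδ0 : 0 ≤ δ := le_max_left _ _
  have hP : ∀ S T : Set (Fin n), S ⊆ T → b ∈ S → b ∈ T := fun S T hST hb => hST hb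
  have hyp : (prodBernoulli w).real {ω | b ∈ {y | ω ∈ openConnIn ({o}ᶜ : Set (Fin n)) c y}} ≤
      (prodBernoulli w).real {ω | b ∈ {y | ω ∈ openConnIn ({o}ᶜ : Set (Fin n)) (v B) y}} + δ := by
    have h1 : {ω : BondConfig (Fin n) | b ∈ {y | ω ∈ openConnIn ({o}ᶜ : Set (Fin n)) c y}} =
        openConnIn ({o}ᶜ : Set (Fin n)) c b := Set.ext fun _ => Iff.rfl
    have h2 : {ω : BondConfig (Fin n) | b ∈ {y | ω ∈ openConnIn ({o}ᶜ : Set (Fin n)) (v B) y}} =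
        openConnIn ({o}ᶜ : Set (Fin n)) (v B) b := Set.ext fun _ => Iff.rfl
    rw [h1, h2]
    linarith [le_max_right 0 ((prodBernoulli w).real (openConnIn ({o}ᶜ : Set (Fin n)) c b) -
      (prodBernoulli w).real (openConnIn ({o}ᶜ : Set (Fin n)) (v B) b))]
  have hL5 := LossyStar.lemma5_add w o c (v B) (↑B : Set (Fin n)) (fun S => b ∈ S) hP hco (hvo B hB)
    (Finset.mem_coe.2 (hv B hB)) hδ0 hyp
  have hc : {ω : BondConfig (Fin n) | b ∈ openCluster ω c} = openConn c b := Set.ext fun _ => Iff.rfl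
  have ho : {ω : BondConfig (Fin n) | b ∈ openCluster ω o} = openConn o b := Set.ext fun _ => Iff.rfl
  rw [hc, ho] at hL5
  linarith

/-- **Weak-port reduction (R1).**  If every star `B ∈ 𝒱` contains a port `v B` (≠ `o`) that is STRONG for the threshold
`δ`, i.e. `R'(v B) ≥ R'(c) − δ` in `G ∖ {o}`, then the cells of `𝒱` contribute at most `δ⁺ · Σ_{B∈𝒱} μ(σ_B)` to
`μ({c↔b} ∩ ·) − μ({o↔b} ∩ ·)`.  With `δ = μ(c↔b) − min_{v∈A} μ(v↔b)` these are the cells one may discard when proving the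
signed up-set star inequality (FINDINGS-fat-minority-gen9 §2 (R1)). [cite: KozmaNitzan2024, Lemma 5 p. 13; this use: route notes gen 9] -/
theorem strongCells_le (w : Sym2 (Fin n) → unitInterval) (o c b : Fin n) (hco : c ≠ o) (δ : ℝ)
    (𝒱 : Finset (Finset (Fin n))) (v : Finset (Fin n) → Fin n)
    (hv : ∀ B ∈ 𝒱, v B ∈ B) (hvo : ∀ B ∈ 𝒱, v B ≠ o)
    (hstrong : ∀ B ∈ 𝒱, (prodBernoulli w).real (openConnIn ({o}ᶜ : Set (Fin n)) c b) - δ ≤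
      (prodBernoulli w).real (openConnIn ({o}ᶜ : Set (Fin n)) (v B) b)) :
    ∑ B ∈ 𝒱, ((prodBernoulli w).real (openConn c b ∩ starEvent o (↑B : Set (Fin n))) -
        (prodBernoulli w).real (openConn o b ∩ starEvent o (↑B : Set (Fin n)))) ≤
      max 0 δ * ∑ B ∈ 𝒱, (prodBernoulli w).real (starEvent o (↑B : Set (Fin n))) := by
  refine (cells_le_slack w o c b hco 𝒱 v hv hvo).trans ?_
  rw [Finset.mul_sum]
  refine Finset.sum_le_sum fun B hB => ?_
  refine mul_le_mul_of_nonneg_right ?_ measureReal_nonneg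
  refine max_le (le_max_left _ _) ?_
  exact (by linarith [hstrong B hB] : (prodBernoulli w).real (openConnIn ({o}ᶜ : Set (Fin n)) c b) -
      (prodBernoulli w).real (openConnIn ({o}ᶜ : Set (Fin n)) (v B) b) ≤ δ).trans (le_max_right _ _)

end

end Summit.CriticalPhenomena.PercolationContinuityZ3.Theorems
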